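import Mathlib
import Summits.Ventures.HodgeRepro.Tier4.Common.AdelicRTF
import Summits.Ventures.HodgeRepro.Tier4.Common.AdelicHaar
import Summits.Ventures.HodgeRepro.Tier4.Common.MixedPlaneCusp
import Summits.Ventures.HodgeRepro.Tier4.Line1.FiniteLevelIsolation
import Summits.Ventures.HodgeRepro.Tier4.Line1.RationalPoints
import Summits.Ventures.HodgeRepro.Tier4.Line1.LocallyCompactGA
import Summits.Ventures.HodgeRepro.Tier4.Line1.SecondCountableGA
import Summits.Ventures.HodgeRepro.Tier4.Line4.FinitePlacePositivity
import Summits.Ventures.HodgeRepro.Tier4.Line4.OrbitalUnfold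
import Summits.Ventures.HodgeRepro.Tier4.Line4.FinitePartClosed
import Summits.Ventures.HodgeRepro.Tier4.Line4.TorusProduct
import Summits.Ventures.HodgeRepro.Tier4.Line4.TorusProductHaar
import Summits.Ventures.HodgeRepro.Tier4.Line4.InnerSplit
import Summits.Ventures.HodgeRepro.Tier4.Line4.CentreFinDomain
import Summits.Ventures.HodgeRepro.Tier4.Line4.ProperDefs

/-!
# Tier4/Line4/IntegProper — C-L4-INTEG, the PROPER-bearing three: (B1), (C-hIfin), (D)

Blind re-derivation cell `pub-hodge-repro`, Tier 4 «prove the step» (README §9–§10), seat t4-L2-p1 (gen 3; L4 service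
prover, lead (R-6′) S14693; plan-4 g3's C-L4-INTEG v2, statements VERBATIM from
proofs/t4-plan-4/work/Integ-Concat-v2.lean efc313b641e3a2f3 · 671, Part 8 L469–L613, with crit-1's trims S14664 / S14670;
idle binders `_`-prefixed in place).  Tree path `lean/Summits/Ventures/HodgeRepro/Tier4/Line4/IntegProper.lean`.
Imports `Line4/ProperDefs` (`diagCentreFin`, `HasProperFinOrbit`), `Line4/CentreFinDomain` (`prodDomain`, `ZfIn`,
`prodDomain_eq_preimage`), `Line4/InnerSplit` (`innerFin`), `Line4/OrbitalUnfold` (`innerFull`, `innerFn`).  Mathlib-level; no literature.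

THE ARGUMENT (one compactness lemma, then Fubini).  PROPER (`HasProperFinOrbit`, L2-p3's C-L4-PROPER conclusion as a
predicate of `γ₀`) gives, for a compact `C ⊆ G(𝔸)`, a compact `C′ ⊆ T_f × T′_f` with
`{(b, b′) : b⁻¹ γ₀,f b′ ∈ C} ⊆ C′ · Δ(Z_f)`; ZDOMAIN-EX (iv) (`hDZc`) makes `DZ_f ∩ C′₁ Z_f` relatively compact.  So a pair
`(b, b′)` with `b ∈ DZ_f` and `b⁻¹ γ₀,f b′ ∈ C` has `b ∈ K₁ := closure (DZ_f ∩ C′₁ Z_f)` and, writing `(b, b′) = c · (z, z)`,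
`z = c₁⁻¹ b ∈ C′₁⁻¹ K₁` and `b′ = c₂ z ∈ K₂ := C′₂ · ι′⁻¹(ι(C′₁⁻¹ K₁))` — compact because `T′_f` is CLOSED in `G(𝔸)`
(`isClosed_torusT'`, `isClosed_subgroupOf_finitePart`), so its inclusion is a closed embedding
(`mem_compact_of_hasProperFinOrbit`).  (D) then reads: the continuous integrand vanishes on `(DZ_f × T′_f) \ (K₁ × K₂)`
(`hFsupp` + the parts lie in `G(𝔸_f)`), is integrable on the compact `K₁ × K₂` for the product Haar measure
(`ContinuousOn.integrableOn_compact`), hence on `DZ_f × T′_f` (`IntegrableOn.of_forall_sdiff_eq_zero`).  (C-hIfin) is (D)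
integrated out along `T′_f` (`Integrable.integral_prod_left`, `restrict_prod_eq_prod_univ`; `integral_const_mul`).  (B1) is
the same pattern on `T(𝔸) × T′(𝔸)` with `C := (·)_f '' tsupport F`: a pair `(t, t′)` with `t ∈ T_∞ × DZ_f` and
`F(t⁻¹ γ₀ t′) ≠ 0` has `(t_f, t′_f)` in the situation above, so `t ∈ T_∞ × K₁`, `t′ ∈ T′_∞ × K₂` — compact by the displayed
`[CompactSpace (torusInf W)]`, `[CompactSpace (torusInf' W)]` — and Fubini gives `χ · innerFull` integrable on the product
domain.

Nothing here says anything about the status of the Hodge conjecture for CM abelian varieties, which is NOT proved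
(HC_CM is NOT proved by anyone in this repository).
-/

set_option autoImplicit false
noncomputable section
namespace Summit.Ventures.HodgeRepro.Tier4.Line4
open Summit.Ventures.HodgeRepro.Tier4 Summit.Ventures.HodgeRepro.Tier4.Common
  Summit.Ventures.HodgeRepro.Tier4.Line1 MeasureTheory
open scoped ComplexConjugate Topology Pointwise NNReal

/-! ## Part 1 — the compactness lemma (PROPER = `HasProperFinOrbit`, ProperDefs) -/

section Proper
variable {k : Type} [Field k] [NumberField k] (W : PlaneData k)

/-- The inclusion `T_f → G(𝔸)` is a closed embedding (`T` closed in `G(𝔸)`, `T_f` closed in `T`). -/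
theorem isClosedEmbedding_torusFin_coe :
    Topology.IsClosedEmbedding (fun b : torusFin W => ((b : torusT W) : GA W)) :=
  (Common.isClosed_torusT W).isClosedEmbedding_subtypeVal.comp
    (isClosed_subgroupOf_finitePart W (torusT W)).isClosedEmbedding_subtypeVal

/-- The inclusion `T′_f → G(𝔸)` is a closed embedding. -/
theorem isClosedEmbedding_torusFin'_coe :
    Topology.IsClosedEmbedding (fun b : torusFin' W => ((b : torusT' W) : GA W)) :=
  (Common.isClosed_torusT' W).isClosedEmbedding_subtypeVal.comp
    (isClosed_subgroupOf_finitePart W (torusT' W)).isClosedEmbedding_subtypeVal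

/-- **The compactness lemma of C-L4-INTEG**: under PROPER and ZDOMAIN-EX (iv), for every compact `C ⊆ G(𝔸)` there are
compact `K₁ ⊆ T_f`, `K₂ ⊆ T′_f` such that every pair `(b, b′)` with `b ∈ DZ_f` and `b⁻¹ γ₀,f b′ ∈ C` lies in `K₁ × K₂`
(`K₁ = closure (DZ_f ∩ C′₁ Z_f)`, `K₂ = C′₂ · ι′⁻¹ ι (C′₁⁻¹ K₁)`). -/
theorem mem_compact_of_hasProperFinOrbit (γ₀ : GA W) (hprop : HasProperFinOrbit W γ₀)
    (DZf : Set (torusFin W))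
    (hDZc : ∀ C : Set (torusFin W), IsCompact C → IsCompact (closure (DZf ∩ (C * (ZfIn W : Set (torusFin W))))))
    (C : Set (GA W)) (hC : IsCompact C) :
    ∃ K₁ : Set (torusFin W), ∃ K₂ : Set (torusFin' W), IsCompact K₁ ∧ IsCompact K₂ ∧
      ∀ p : torusFin W × torusFin' W, p.1 ∈ DZf →
        (((p.1 : torusT W) : GA W))⁻¹ * GA.ofFinPart W γ₀ * ((p.2 : torusT' W) : GA W) ∈ C →
        p.1 ∈ K₁ ∧ p.2 ∈ K₂ := by
  obtain ⟨C', hC', hsub⟩ := hprop C hC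
  have hC₁ : IsCompact (Prod.fst '' C') := hC'.image continuous_fst
  have hC₂ : IsCompact (Prod.snd '' C') := hC'.image continuous_snd
  obtain ⟨K₁, hK₁, hK₁sub⟩ : ∃ K₁ : Set (torusFin W), IsCompact K₁ ∧
      DZf ∩ (Prod.fst '' C' * (ZfIn W : Set (torusFin W))) ⊆ K₁ := ⟨_, hDZc _ hC₁, subset_closure⟩
  have hKz : IsCompact ((Prod.fst '' C')⁻¹ * K₁) := hC₁.inv.mul hK₁
  have hKzG : IsCompact ((fun z : torusFin W => ((z : torusT W) : GA W)) '' ((Prod.fst '' C')⁻¹ * K₁)) :=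
    hKz.image (continuous_subtype_val.comp continuous_subtype_val)
  have hpre : IsCompact ((fun b : torusFin' W => ((b : torusT' W) : GA W)) ⁻¹'
      ((fun z : torusFin W => ((z : torusT W) : GA W)) '' ((Prod.fst '' C')⁻¹ * K₁))) :=
    (isClosedEmbedding_torusFin'_coe W).isCompact_preimage hKzG
  refine ⟨K₁, Prod.snd '' C' * ((fun b : torusFin' W => ((b : torusT' W) : GA W)) ⁻¹'
    ((fun z : torusFin W => ((z : torusT W) : GA W)) '' ((Prod.fst '' C')⁻¹ * K₁))), hK₁, hC₂.mul hpre, ?_⟩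
  intro p hp1 hpC
  obtain ⟨c, hc, q, hq, hcq⟩ := Set.mem_mul.1 (hsub hpC)
  obtain ⟨z, hz, hq1, hq2⟩ := hq
  have hp1eq : p.1 = c.1 * q.1 := by rw [← hcq]; rfl
  have hp2eq : p.2 = c.2 * q.2 := by rw [← hcq]; rfl
  have hq1Z : q.1 ∈ ZfIn W := by
    rw [ZfIn, Subgroup.mem_subgroupOf, Subgroup.mem_subgroupOf, hq1]
    exact hz
  have hp1K : p.1 ∈ K₁ := hK₁sub ⟨hp1, by rw [hp1eq]; exact Set.mul_mem_mul ⟨c, hc, rfl⟩ hq1Z⟩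
  have hq1Kz : q.1 ∈ (Prod.fst '' C')⁻¹ * K₁ := by
    have : q.1 = (c.1)⁻¹ * p.1 := by rw [hp1eq, inv_mul_cancel_left]
    rw [this]
    exact Set.mul_mem_mul (Set.inv_mem_inv.2 ⟨c, hc, rfl⟩) hp1K
  refine ⟨hp1K, ?_⟩
  rw [hp2eq]
  refine Set.mul_mem_mul ⟨c, hc, rfl⟩ ?_
  show ((q.2 : torusT' W) : GA W) ∈
    (fun z : torusFin W => ((z : torusT W) : GA W)) '' ((Prod.fst '' C')⁻¹ * K₁)
  rw [hq2, ← hq1]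
  exact ⟨q.1, hq1Kz, rfl⟩

end Proper

/-! ## Part 2 — C-L4-INTEG (B1), (C-hIfin), (D), statements verbatim (Integ-Concat-v2 Part 8) -/

section Integ
variable {k : Type} [Field k] [NumberField k] (W : PlaneData k) [MeasurableSpace (GA W)] [BorelSpace (GA W)]
  (R : RTFData W)

/-- (D-hint) FINSUM's product integrability on `DZ_f × T′_f`: the support is contained in
`(DZ_f ∩ C′₁ Z_f) × (C′₂ C′₁⁻¹ (DZ_f ∩ C′₁ Z_f))`, relatively compact, and the integrand is bounded. -/
theorem integrableOn_chi_conj_chi'_Ffin_prod (hc : Continuous R.chi) (_hu : ∀ a, ‖R.chi a‖ = 1)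
    (hc' : Continuous R.chi') (_hu' : ∀ a, ‖R.chi' a‖ = 1)
    (νf : Measure (torusFin W)) [νf.IsHaarMeasure] (νf' : Measure (torusFin' W)) [νf'.IsHaarMeasure]
    (Ffin : GA W → ℂ) (hFc : Continuous Ffin)
    (Cf : Set (GA W)) (hCf : IsCompact Cf) (hFsupp : ∀ g ∈ finitePart W, Ffin g ≠ 0 → g ∈ Cf)
    (γ₀ : GA W) (hprop : HasProperFinOrbit W γ₀) (DZf : Set (torusFin W)) (hDZf : MeasurableSet DZf)
    (hDZc : ∀ C : Set (torusFin W), IsCompact C → IsCompact (closure (DZf ∩ (C * (ZfIn W : Set (torusFin W)))))) :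
    IntegrableOn (fun p : torusFin W × torusFin' W => R.chi p.1 * conj (R.chi' p.2) *
      Ffin ((((p.1 : torusT W) : GA W))⁻¹ * GA.ofFinPart W γ₀ * ((p.2 : torusT' W) : GA W)))
      (DZf ×ˢ Set.univ) (νf.prod νf') := by
  haveI : T2Space (GA W) := t2Space_GA W
  haveI : SecondCountableTopology (torusFin W) := secondCountable_torusFin W
  haveI : SecondCountableTopology (torusFin' W) := secondCountable_torusFin' W
  haveI : BorelSpace (torusT W) := Subtype.borelSpace _
  haveI : BorelSpace (torusT' W) := Subtype.borelSpace _
  haveI : BorelSpace (torusFin W) := Subtype.borelSpace _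
  haveI : BorelSpace (torusFin' W) := Subtype.borelSpace _
  haveI : BorelSpace (torusFin W × torusFin' W) := Prod.borelSpace
  obtain ⟨K₁, K₂, hK₁, hK₂, hmem⟩ := mem_compact_of_hasProperFinOrbit W γ₀ hprop DZf hDZc Cf hCf
  have hcont : Continuous (fun p : torusFin W × torusFin' W => R.chi p.1 * conj (R.chi' p.2) *
      Ffin ((((p.1 : torusT W) : GA W))⁻¹ * GA.ofFinPart W γ₀ * ((p.2 : torusT' W) : GA W))) := by
    have h1 : Continuous fun p : torusFin W × torusFin' W => ((p.1 : torusT W) : GA W) :=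
      continuous_subtype_val.comp (continuous_subtype_val.comp continuous_fst)
    have h2 : Continuous fun p : torusFin W × torusFin' W => ((p.2 : torusT' W) : GA W) :=
      continuous_subtype_val.comp (continuous_subtype_val.comp continuous_snd)
    exact ((hc.comp (continuous_subtype_val.comp continuous_fst)).mul
      (Complex.continuous_conj.comp (hc'.comp (continuous_subtype_val.comp continuous_snd)))).mul
      (hFc.comp ((h1.inv.mul continuous_const).mul h2))
  have hK : IntegrableOn (fun p : torusFin W × torusFin' W => R.chi p.1 * conj (R.chi' p.2) *
      Ffin ((((p.1 : torusT W) : GA W))⁻¹ * GA.ofFinPart W γ₀ * ((p.2 : torusT' W) : GA W)))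
      (K₁ ×ˢ K₂) (νf.prod νf') :=
    hcont.continuousOn.integrableOn_compact (hK₁.prod hK₂)
  refine hK.of_forall_sdiff_eq_zero (hDZf.prod MeasurableSet.univ) ?_
  intro p hp
  by_contra hne
  have hF : Ffin ((((p.1 : torusT W) : GA W))⁻¹ * GA.ofFinPart W γ₀ * ((p.2 : torusT' W) : GA W)) ≠ 0 := by
    intro h0
    exact hne (by rw [h0, mul_zero])
  have harg : (((p.1 : torusT W) : GA W))⁻¹ * GA.ofFinPart W γ₀ * ((p.2 : torusT' W) : GA W) ∈ finitePart W :=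
    (finitePart W).mul_mem ((finitePart W).mul_mem ((finitePart W).inv_mem (Subgroup.mem_subgroupOf.1 p.1.2))
      (ofFinPart_mem_finitePart W γ₀)) (Subgroup.mem_subgroupOf.1 p.2.2)
  have hK12 := hmem p hp.1.1 (hFsupp _ harg hF)
  exact hp.2 ⟨hK12.1, hK12.2⟩

/-- (C-hIfin) `b ↦ χ(b) I_f(b)` is integrable on `DZ_f`: supported in `DZ_f ∩ C′₁ Z_f` (relatively compact by
ZDOMAIN-EX (iv)) and bounded (PROPER). -/
theorem integrableOn_chi_mul_innerFin (hc : Continuous R.chi) (_hu : ∀ a, ‖R.chi a‖ = 1)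
    (hc' : Continuous R.chi') (_hu' : ∀ a, ‖R.chi' a‖ = 1)
    (νf : Measure (torusFin W)) [νf.IsHaarMeasure] (νf' : Measure (torusFin' W)) [νf'.IsHaarMeasure]
    (Ffin : GA W → ℂ) (hFc : Continuous Ffin)
    (Cf : Set (GA W)) (hCf : IsCompact Cf) (hFsupp : ∀ g ∈ finitePart W, Ffin g ≠ 0 → g ∈ Cf)
    (γ₀ : GA W) (hprop : HasProperFinOrbit W γ₀) (DZf : Set (torusFin W)) (hDZf : MeasurableSet DZf)
    (hDZc : ∀ C : Set (torusFin W), IsCompact C → IsCompact (closure (DZf ∩ (C * (ZfIn W : Set (torusFin W)))))) :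
    IntegrableOn (fun b : torusFin W => R.chi b * innerFin W R Ffin γ₀ νf' b) DZf νf := by
  haveI : LocallyCompactSpace (torusFin W) := locallyCompact_torusFin W
  haveI : LocallyCompactSpace (torusFin' W) := locallyCompact_torusFin' W
  haveI : SecondCountableTopology (torusFin W) := secondCountable_torusFin W
  haveI : SecondCountableTopology (torusFin' W) := secondCountable_torusFin' W
  haveI : IsLocallyFiniteMeasure νf := isLocallyFiniteMeasure_of_isFiniteMeasureOnCompacts
  haveI : IsLocallyFiniteMeasure νf' := isLocallyFiniteMeasure_of_isFiniteMeasureOnCompacts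
  haveI : SigmaFinite νf := sigmaFinite_of_locallyFinite
  haveI : SigmaFinite νf' := sigmaFinite_of_locallyFinite
  have hD := integrableOn_chi_conj_chi'_Ffin_prod W R hc _hu hc' _hu' νf νf' Ffin hFc Cf hCf hFsupp γ₀ hprop
    DZf hDZf hDZc
  rw [IntegrableOn, ← Measure.restrict_prod_eq_prod_univ] at hD
  refine hD.integral_prod_left.congr (Filter.Eventually.of_forall fun b => ?_)
  show ∫ b' : torusFin' W, R.chi b * conj (R.chi' (b' : torusT' W)) *
      Ffin ((((b : torusT W) : GA W))⁻¹ * GA.ofFinPart W γ₀ * ((b' : torusT' W) : GA W)) ∂νf' =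
    R.chi b * innerFin W R Ffin γ₀ νf' b
  unfold innerFin
  rw [← integral_const_mul]
  exact integral_congr_ae (Filter.Eventually.of_forall fun b' => mul_assoc _ _ _)

/-- (B1) `t ↦ χ(t) · innerFull F γ₀ t` is integrable on the product domain `T_∞ × DZ_f`: its support lies in
`T_∞ × (DZ_f ∩ C′₁ Z_f)`, relatively compact by ZDOMAIN-EX (iv), and it is bounded there by PROPER. -/
theorem integrableOn_chi_mul_innerFull_prodDomain [CompactSpace (torusInf W)] [CompactSpace (torusInf' W)]
    (hR : R.IsHaar) (hc : Continuous R.chi) (_hu : ∀ a, ‖R.chi a‖ = 1) (hc' : Continuous R.chi')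
    (_hu' : ∀ a, ‖R.chi' a‖ = 1) (F : GA W → ℂ) (hFc : Continuous F) (hFs : HasCompactSupport F)
    (γ₀ : rationalPoints W) (hprop : HasProperFinOrbit W (γ₀ : GA W))
    (DZf : Set (torusFin W)) (hDZf : MeasurableSet DZf)
    (hDZc : ∀ C : Set (torusFin W), IsCompact C → IsCompact (closure (DZf ∩ (C * (ZfIn W : Set (torusFin W)))))) :
    IntegrableOn (fun t : torusT W => R.chi t * innerFull W R F (γ₀ : GA W) t) (prodDomain W DZf) R.μT := by
  haveI : R.μT.IsHaarMeasure := hR.1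
  haveI : R.μT'.IsHaarMeasure := hR.2.1
  haveI : T2Space (GA W) := t2Space_GA W
  haveI := secondCountable_GA W
  haveI : LocallyCompactSpace (torusT W) := locallyCompact_torusT W
  haveI : LocallyCompactSpace (torusT' W) := locallyCompactSpace_torusT' W
  haveI : SecondCountableTopology (torusT W) := secondCountable_torusT W
  haveI : SecondCountableTopology (torusT' W) :=
    TopologicalSpace.Subtype.secondCountableTopology (torusT' W : Set (GA W))
  haveI : BorelSpace (torusT W) := Subtype.borelSpace _
  haveI : BorelSpace (torusT' W) := Subtype.borelSpace _
  haveI : BorelSpace (torusFin W) := Subtype.borelSpace _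
  haveI : BorelSpace (torusT W × torusT' W) := Prod.borelSpace
  haveI : IsLocallyFiniteMeasure R.μT := isLocallyFiniteMeasure_of_isFiniteMeasureOnCompacts
  haveI : IsLocallyFiniteMeasure R.μT' := isLocallyFiniteMeasure_of_isFiniteMeasureOnCompacts
  haveI : SigmaFinite R.μT := sigmaFinite_of_locallyFinite
  haveI : SigmaFinite R.μT' := sigmaFinite_of_locallyFinite
  -- the compact sets
  have hCs : IsCompact (GA.ofFinPart W '' tsupport F) := hFs.image (continuous_ofFinPart W)
  obtain ⟨K₁, K₂, hK₁, hK₂, hmem⟩ :=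
    mem_compact_of_hasProperFinOrbit W (γ₀ : GA W) hprop DZf hDZc _ hCs
  have hK : IsCompact ((torusSplit W).symm '' (Set.univ ×ˢ K₁)) :=
    (isCompact_univ.prod hK₁).image (torusSplit W).symm.continuous
  have hK' : IsCompact ((torusSplit' W).symm '' (Set.univ ×ˢ K₂)) :=
    (isCompact_univ.prod hK₂).image (torusSplit' W).symm.continuous
  have hP : MeasurableSet (prodDomain W DZf) := by
    rw [prodDomain_eq_preimage]
    exact hDZf.preimage (continuous_snd.comp (torusSplit W).continuous).measurable
  -- the joint integrand
  have hfc : Continuous (fun q : torusT W × torusT' W => R.chi q.1 * innerFn W R F (γ₀ : GA W) q.1 q.2) := by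
    show Continuous fun q : torusT W × torusT' W =>
      R.chi q.1 * (conj (R.chi' q.2) * F ((q.1 : GA W)⁻¹ * (γ₀ : GA W) * (q.2 : GA W)))
    have h1 : Continuous fun q : torusT W × torusT' W => (q.1 : GA W) :=
      continuous_subtype_val.comp continuous_fst
    have h2 : Continuous fun q : torusT W × torusT' W => (q.2 : GA W) :=
      continuous_subtype_val.comp continuous_snd
    exact (hc.comp continuous_fst).mul ((Complex.continuous_conj.comp (hc'.comp continuous_snd)).mul
      (hFc.comp ((h1.inv.mul continuous_const).mul h2)))
  have hfK : IntegrableOn (fun q : torusT W × torusT' W => R.chi q.1 * innerFn W R F (γ₀ : GA W) q.1 q.2)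
      (((torusSplit W).symm '' (Set.univ ×ˢ K₁)) ×ˢ ((torusSplit' W).symm '' (Set.univ ×ˢ K₂)))
      (R.μT.prod R.μT') :=
    hfc.continuousOn.integrableOn_compact (hK.prod hK')
  have hfP : IntegrableOn (fun q : torusT W × torusT' W => R.chi q.1 * innerFn W R F (γ₀ : GA W) q.1 q.2)
      (prodDomain W DZf ×ˢ Set.univ) (R.μT.prod R.μT') := by
    refine hfK.of_forall_sdiff_eq_zero (hP.prod MeasurableSet.univ) ?_
    intro q hq
    by_contra hne
    have hF0 : F ((q.1 : GA W)⁻¹ * (γ₀ : GA W) * (q.2 : GA W)) ≠ 0 := by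
      intro h0
      apply hne
      show R.chi q.1 * (R.chi'conj q.2 * F ((q.1 : GA W)⁻¹ * (γ₀ : GA W) * (q.2 : GA W))) = 0
      rw [h0, mul_zero, mul_zero]
    have hts : (q.1 : GA W)⁻¹ * (γ₀ : GA W) * (q.2 : GA W) ∈ tsupport F := subset_tsupport F hF0
    have hC : GA.ofFinPart W ((q.1 : GA W)⁻¹ * (γ₀ : GA W) * (q.2 : GA W)) ∈ GA.ofFinPart W '' tsupport F :=
      ⟨_, hts, rfl⟩
    have hrw : GA.ofFinPart W ((q.1 : GA W)⁻¹ * (γ₀ : GA W) * (q.2 : GA W)) =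
        (((finTf W q.1 : torusT W) : GA W))⁻¹ * GA.ofFinPart W (γ₀ : GA W) * ((finTf' W q.2 : torusT' W) : GA W) := by
      rw [ofFinPart_mul, ofFinPart_mul, ofFinPart_inv]
      rfl
    have hb : finTf W q.1 ∈ DZf := by
      have h := hq.1.1
      rw [prodDomain_eq_preimage] at h
      exact h
    have hK12 : finTf W q.1 ∈ K₁ ∧ finTf' W q.2 ∈ K₂ := by
      refine hmem (finTf W q.1, finTf' W q.2) hb ?_
      show (((finTf W q.1 : torusT W) : GA W))⁻¹ * GA.ofFinPart W (γ₀ : GA W) *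
        ((finTf' W q.2 : torusT' W) : GA W) ∈ GA.ofFinPart W '' tsupport F
      rw [← hrw]
      exact hC
    refine hq.2 ⟨?_, ?_⟩
    · exact ⟨torusSplit W q.1, ⟨Set.mem_univ _, hK12.1⟩, (torusSplit W).symm_apply_apply q.1⟩
    · exact ⟨torusSplit' W q.2, ⟨Set.mem_univ _, hK12.2⟩, (torusSplit' W).symm_apply_apply q.2⟩
  rw [IntegrableOn, ← Measure.restrict_prod_eq_prod_univ] at hfP
  refine hfP.integral_prod_left.congr (Filter.Eventually.of_forall fun t => ?_)
  show ∫ t' : torusT' W, R.chi t * innerFn W R F (γ₀ : GA W) t t' ∂(R.μT') = R.chi t * innerFull W R F (γ₀ : GA W) t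
  unfold innerFull
  rw [integral_const_mul]

end Integ

end Summit.Ventures.HodgeRepro.Tier4.Line4

end
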